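import Summits.ValiantsHypothesis.ValiantsHypothesis.Theorems.KPlusLogSqLawStaticPathTwoChains

/-!
# Route «KPlusLogSqLaw» — parametric max-weight independent set on a path: THE TWO-CHAIN CALCULUS, STEP LEMMAS (flip cases, events flip both ends)

HONEST FRAMING.  Helper toward the crux `WeakLifting` (item `stmt-ValiantsHypothesis-19561`, route `KPlusLogSqLaw`, cell `pub-symmetroid`,
seat val-sym-lift-p4 g24, 2026-08-29) on the line of its witness-plan stub `stub_tridiagonalSectorB` (tropical twin of the STATIC tridiagonal
sector = parametric maximum-weight independent set on a path; located theory `HOME/val-sym-lift-p4/SILENT-FLIP-LAW.md` §1 (F1)–(F4)).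
Sequel of `…StaticPathTwoChains` (abstract greedy record chains; `left_transposition` / `right_transposition`).  For two states that differ by
an adjacent transposition of the labels `a < c ≤ n` (greedy semantics with offset `e` on both sides, all other pairs compare the same way,
values distinct, the pair adjacent in the first state):
* `left_flip_cases` / `right_flip_cases` — (F1)+(F4): if the left-record bit of some label changes, that label is `c`, `a` is the nearest left
  record of `c` in both states, and if moreover `c` is a right record then no right record lies strictly between (the step is an EVENT);
  mirror for a right-record bit (the label is `a`, `c` its nearest right record, and `a` a left record makes it an event);
* `event_flips` — (F3): at an event (`a` left record, `c` right record, no record strictly between) whose pair reverses its order, the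
  left bit of `c` and the right bit of `a` both flip, while `a` stays a left record and `c` a right record;
* `parity_clash` — two labels each correct with respect to the other have opposite parities (the creation/annihilation signature);
* `iff_of_steps` — bookkeeping: a predicate unchanged across every step of a window has equal values at its ends.
Pure finite combinatorics; nothing here asserts anything about `WeakLifting`, `TropicalB`, `KPlusLogSqLaw`, the stub in its window,
`MatrixDescartes` (stmt-ValiantsHypothesis-18050) or `VP ≠ VNP`; the ORDER QUESTION stays open.
-/

set_option linter.dupNamespace false
set_option autoImplicit false

namespace Summit.ValiantsHypothesis.ValiantsHypothesis.Theorems.KPlusLogSqLaw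

open Finset Classical

namespace StaticPathFold

section TwoChainsSteps

variable {β : Type*} [LinearOrder β]

/-! ## 1. Bookkeeping -/

/-- a predicate that does not change across any step of `[k₁, k₂)` has the same value at `k₂` and at `k₁`. [folklore] -/
theorem iff_of_steps {P : ℕ → Prop} {k₁ k₂ : ℕ} (hk : k₁ ≤ k₂) (h : ∀ k, k₁ ≤ k → k < k₂ → (P (k + 1) ↔ P k)) :
    P k₂ ↔ P k₁ := by
  induction k₂ with
  | zero =>
    have h0 : k₁ = 0 := by omega
    subst h0
    exact Iff.rfl
  | succ m ih =>
    rcases Nat.eq_or_lt_of_le hk with h1 | h1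
    · rw [h1]
    · exact (h m (by omega) (by omega)).trans (ih (by omega) (fun k h2 h3 => h k h2 (by omega)))

/-- **parity clash**: two labels with distinct heights, each correct with respect to the other, have opposite parities; and then the one
of even parity is the higher. [folklore] -/
theorem parity_clash {S : ℕ → β} {e z v : ℕ} (hne : S z ≠ S v)
    (h1 : ¬ ((Even (z + e) → S z < S v) ∧ (¬ Even (z + e) → S v < S z)))
    (h2 : ¬ ((Even (v + e) → S v < S z) ∧ (¬ Even (v + e) → S z < S v))) :
    (Even (z + e) ↔ ¬ Even (v + e)) ∧ (Even (z + e) → S v < S z) ∧ (¬ Even (z + e) → S z < S v) := by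
  rcases lt_or_gt_of_ne hne with h | h
  · by_cases hz : Even (z + e)
    · exact absurd ⟨fun _ => h, fun h' => absurd hz h'⟩ h1
    · by_cases hv : Even (v + e)
      · exact ⟨iff_of_false hz (fun h' => h' hv), fun h' => absurd h' hz, fun _ => h⟩
      · exact absurd ⟨fun h' => absurd h' hv, fun _ => h⟩ h2
  · by_cases hz : Even (z + e)
    · by_cases hv : Even (v + e)
      · exact absurd ⟨fun _ => h, fun h' => absurd hv h'⟩ h2
      · exact ⟨iff_of_true hz hv, fun _ => h, fun h' => absurd hz h'⟩
    · exact absurd ⟨fun h' => absurd h' hz, fun _ => h⟩ h1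

/-! ## 2. Where a bit can change: flip cases -/

/-- **(F1)+(F4), left bit.**  If across an adjacent transposition of `(a, c)` the left-record bit of a label `z ≤ n` changes, then `z = c`,
`a` is the nearest left record of `c` in both states, and if `c` is a right record in the first state then no right record lies strictly
between `a` and `c` there (the step is an event). [folklore] -/
theorem left_flip_cases (S S' : ℕ → β) (e n a c : ℕ) {Lr Lr' Rr : ℕ → Prop} (hac : a < c) (hcn : c ≤ n)
    (hL0 : Lr 0) (hL0' : Lr' 0)
    (hSem : ∀ p u, p < u → u ≤ n → Lr p → (∀ q, p < q → q < u → ¬ Lr q) →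
      (Lr u ↔ ((Even (u + e) → S u < S p) ∧ (¬ Even (u + e) → S p < S u))))
    (hSem' : ∀ p u, p < u → u ≤ n → Lr' p → (∀ q, p < q → q < u → ¬ Lr' q) →
      (Lr' u ↔ ((Even (u + e) → S' u < S' p) ∧ (¬ Even (u + e) → S' p < S' u))))
    (hSemR : ∀ u r, u < r → r ≤ n → Rr r → (∀ q, u < q → q < r → ¬ Rr q) →
      (Rr u ↔ ((Even (u + e) → S u < S r) ∧ (¬ Even (u + e) → S r < S u))))
    (hord : ∀ p q, p ≤ n → q ≤ n → ¬(p = a ∧ q = c) → ¬(p = c ∧ q = a) → (S p < S q ↔ S' p < S' q))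
    (hdis : ∀ p q, p ≤ n → q ≤ n → p ≠ q → S p ≠ S q)
    (hadj : ∀ q, q ≤ n → q ≠ a → q ≠ c → (S q < S a ↔ S q < S c))
    {z : ℕ} (hz : z ≤ n) (hch : ¬ (Lr' z ↔ Lr z)) :
    z = c ∧ (Lr a ∧ ∀ q, a < q → q < c → ¬ Lr q) ∧ (Lr' a ∧ ∀ q, a < q → q < c → ¬ Lr' q) ∧
      (Rr c → ∀ q, a < q → q < c → ¬ Rr q) := by
  obtain ⟨h1, h2, h3⟩ := left_transposition S S' e n a c hac hcn hL0 hL0' hSem hSem' hord hdis hadj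
  have hzc : z = c := by
    by_contra h
    exact hch (h1 z hz h)
  subst hzc
  have hna : Lr a ∧ ∀ q, a < q → q < z → ¬ Lr q := by
    by_contra h
    exact hch (h2 h)
  exact ⟨rfl, hna, h3 hna, fun hRc => noR_of_noL S e n hSem hSemR hdis hac hcn hna.1 hna.2 hRc hadj⟩

/-- **(F1)+(F4), right bit** (mirror): if the right-record bit of a label `z ≤ n` changes, then `z = a`, `c` is the nearest right record of
`a` in both states, and if `a` is a left record in the first state then no left record lies strictly between. [folklore] -/
theorem right_flip_cases (S S' : ℕ → β) (e n a c : ℕ) {Lr Rr Rr' : ℕ → Prop} (hac : a < c) (hcn : c ≤ n)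
    (hRn : Rr n) (hRn' : Rr' n)
    (hSem : ∀ p u, p < u → u ≤ n → Lr p → (∀ q, p < q → q < u → ¬ Lr q) →
      (Lr u ↔ ((Even (u + e) → S u < S p) ∧ (¬ Even (u + e) → S p < S u))))
    (hSemR : ∀ u r, u < r → r ≤ n → Rr r → (∀ q, u < q → q < r → ¬ Rr q) →
      (Rr u ↔ ((Even (u + e) → S u < S r) ∧ (¬ Even (u + e) → S r < S u))))
    (hSemR' : ∀ u r, u < r → r ≤ n → Rr' r → (∀ q, u < q → q < r → ¬ Rr' q) →
      (Rr' u ↔ ((Even (u + e) → S' u < S' r) ∧ (¬ Even (u + e) → S' r < S' u))))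
    (hord : ∀ p q, p ≤ n → q ≤ n → ¬(p = a ∧ q = c) → ¬(p = c ∧ q = a) → (S p < S q ↔ S' p < S' q))
    (hdis : ∀ p q, p ≤ n → q ≤ n → p ≠ q → S p ≠ S q)
    (hadj : ∀ q, q ≤ n → q ≠ a → q ≠ c → (S q < S a ↔ S q < S c))
    {z : ℕ} (hz : z ≤ n) (hch : ¬ (Rr' z ↔ Rr z)) :
    z = a ∧ (Rr c ∧ ∀ q, a < q → q < c → ¬ Rr q) ∧ (Rr' c ∧ ∀ q, a < q → q < c → ¬ Rr' q) ∧
      (Lr a → ∀ q, a < q → q < c → ¬ Lr q) := by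
  obtain ⟨h1, h2, h3⟩ := right_transposition S S' e n a c hac hcn hRn hRn' hSemR hSemR' hord hdis hadj
  have hza : z = a := by
    by_contra h
    exact hch (h1 z hz h)
  subst hza
  have hnc : Rr c ∧ ∀ q, z < q → q < c → ¬ Rr q := by
    by_contra h
    exact hch (h2 h)
  exact ⟨rfl, hnc, h3 hnc, fun hLa => noL_of_noR S e n hSem hSemR hdis hac hcn hLa hnc.1 hnc.2 hadj⟩

/-! ## 3. (F3) Events flip both end bits -/

/-- **(F3) EVENTS FLIP BOTH ENDS.**  Across an adjacent transposition of `(a, c)` that reverses the order of the pair, at which `a` is a left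
record, `c` a right record and no record lies strictly between: the left bit of `c` flips, the right bit of `a` flips, `a` stays a left
record and `c` stays a right record. [folklore] -/
theorem event_flips (S S' : ℕ → β) (e n a c : ℕ) {Lr Lr' Rr Rr' : ℕ → Prop} (hac : a < c) (hcn : c ≤ n)
    (hL0 : Lr 0) (hL0' : Lr' 0) (hRn : Rr n) (hRn' : Rr' n)
    (hSem : ∀ p u, p < u → u ≤ n → Lr p → (∀ q, p < q → q < u → ¬ Lr q) →
      (Lr u ↔ ((Even (u + e) → S u < S p) ∧ (¬ Even (u + e) → S p < S u))))
    (hSem' : ∀ p u, p < u → u ≤ n → Lr' p → (∀ q, p < q → q < u → ¬ Lr' q) →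
      (Lr' u ↔ ((Even (u + e) → S' u < S' p) ∧ (¬ Even (u + e) → S' p < S' u))))
    (hSemR : ∀ u r, u < r → r ≤ n → Rr r → (∀ q, u < q → q < r → ¬ Rr q) →
      (Rr u ↔ ((Even (u + e) → S u < S r) ∧ (¬ Even (u + e) → S r < S u))))
    (hSemR' : ∀ u r, u < r → r ≤ n → Rr' r → (∀ q, u < q → q < r → ¬ Rr' q) →
      (Rr' u ↔ ((Even (u + e) → S' u < S' r) ∧ (¬ Even (u + e) → S' r < S' u))))
    (hord : ∀ p q, p ≤ n → q ≤ n → ¬(p = a ∧ q = c) → ¬(p = c ∧ q = a) → (S p < S q ↔ S' p < S' q))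
    (hdis : ∀ p q, p ≤ n → q ≤ n → p ≠ q → S p ≠ S q)
    (hdis' : ∀ p q, p ≤ n → q ≤ n → p ≠ q → S' p ≠ S' q)
    (hadj : ∀ q, q ≤ n → q ≠ a → q ≠ c → (S q < S a ↔ S q < S c))
    (hflip : S a < S c ↔ ¬ S' a < S' c)
    (hLa : Lr a) (hnoL : ∀ q, a < q → q < c → ¬ Lr q) (hRc : Rr c) (hnoR : ∀ q, a < q → q < c → ¬ Rr q) :
    (Lr' c ↔ ¬ Lr c) ∧ (Rr' a ↔ ¬ Rr a) ∧ Lr' a ∧ Rr' c := by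
  have han : a ≤ n := hac.le.trans hcn
  obtain ⟨-, -, hL3⟩ := left_transposition S S' e n a c hac hcn hL0 hL0' hSem hSem' hord hdis hadj
  obtain ⟨-, -, hR3⟩ := right_transposition S S' e n a c hac hcn hRn hRn' hSemR hSemR' hord hdis hadj
  obtain ⟨hLa', hnoL'⟩ := hL3 ⟨hLa, hnoL⟩
  obtain ⟨hRc', hnoR'⟩ := hR3 ⟨hRc, hnoR⟩
  -- the four comparisons of the pair
  have hca : S c < S a ↔ ¬ S a < S c :=
    ⟨fun h h' => lt_asymm h h', fun h => lt_of_le_of_ne (not_lt.mp h) (hdis c a hcn han (by omega))⟩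
  have hca' : S' c < S' a ↔ ¬ S' a < S' c :=
    ⟨fun h h' => lt_asymm h h', fun h => lt_of_le_of_ne (not_lt.mp h) (hdis' c a hcn han (by omega))⟩
  refine ⟨?_, ?_, hLa', hRc'⟩
  · rw [hSem' a c hac hcn hLa' hnoL', hSem a c hac hcn hLa hnoL]
    by_cases he : Even (c + e)
    · have e1 : ((Even (c + e) → S' c < S' a) ∧ (¬ Even (c + e) → S' a < S' c)) ↔ S' c < S' a :=
        ⟨fun h => h.1 he, fun h => ⟨fun _ => h, fun h' => absurd he h'⟩⟩
      have e2 : ((Even (c + e) → S c < S a) ∧ (¬ Even (c + e) → S a < S c)) ↔ S c < S a :=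
        ⟨fun h => h.1 he, fun h => ⟨fun _ => h, fun h' => absurd he h'⟩⟩
      rw [e1, e2, hca', hca, not_not, hflip]
    · have e1 : ((Even (c + e) → S' c < S' a) ∧ (¬ Even (c + e) → S' a < S' c)) ↔ S' a < S' c :=
        ⟨fun h => h.2 he, fun h => ⟨fun h' => absurd h' he, fun _ => h⟩⟩
      have e2 : ((Even (c + e) → S c < S a) ∧ (¬ Even (c + e) → S a < S c)) ↔ S a < S c :=
        ⟨fun h => h.2 he, fun h => ⟨fun h' => absurd h' he, fun _ => h⟩⟩
      rw [e1, e2, hflip, not_not]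
  · rw [hSemR' a c hac hcn hRc' hnoR', hSemR a c hac hcn hRc hnoR]
    by_cases he : Even (a + e)
    · have e1 : ((Even (a + e) → S' a < S' c) ∧ (¬ Even (a + e) → S' c < S' a)) ↔ S' a < S' c :=
        ⟨fun h => h.1 he, fun h => ⟨fun _ => h, fun h' => absurd he h'⟩⟩
      have e2 : ((Even (a + e) → S a < S c) ∧ (¬ Even (a + e) → S c < S a)) ↔ S a < S c :=
        ⟨fun h => h.1 he, fun h => ⟨fun _ => h, fun h' => absurd he h'⟩⟩
      rw [e1, e2, hflip, not_not]
    · have e1 : ((Even (a + e) → S' a < S' c) ∧ (¬ Even (a + e) → S' c < S' a)) ↔ S' c < S' a :=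
        ⟨fun h => h.2 he, fun h => ⟨fun h' => absurd h' he, fun _ => h⟩⟩
      have e2 : ((Even (a + e) → S a < S c) ∧ (¬ Even (a + e) → S c < S a)) ↔ S c < S a :=
        ⟨fun h => h.2 he, fun h => ⟨fun h' => absurd h' he, fun _ => h⟩⟩
      rw [e1, e2, hca', hca, hflip, not_not]

end TwoChainsSteps

end StaticPathFold

end Summit.ValiantsHypothesis.ValiantsHypothesis.Theorems.KPlusLogSqLaw
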